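import Literature.Probability.RandomPlanarGeometry.USTPeanoLattice
import HarnessLib

/-!
# Lattice staircases around a quarter circle (grid approximations of a disc, [LSW04] §4.3)

Combinatorics of the explicit grid approximations `D^R` of the unit disc used to discharge the
hypothesis "a family of approximations exists" in `hasSLETrace_eight_of_LSW` (`LSW2004UST.lean`):
for an integer radius `m` we build the monotone lattice staircase `quarter m` from `(m, 0)` to
`(0, m)` hugging the circle of radius `m` from outside (all vertices at distance in
`[m, m + 2)` from the origin), column by column:

* `colHeight m x` — the least `y ≥ 0` with `x² + y² ≥ m²` (`sq_add_colHeight_sq_ge`,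
  `sq_add_colHeight_sub_one_sq_lt`), its values at `x = m, 1, 0` and its monotonicity in `|x|`;
* `colRun m x = [(x, H x), …, (x, H (x-1))]` (the vertices in column `x`) and
  `quarter m = colRun m m ++ ⋯ ++ colRun m 1 ++ [(0, m)]`;
* `UpLeft p q` — the step relation of the staircase (an up-step in a column `x ≥ 1` or a
  left-step at a height `y ≥ 1`); `isChain_upLeft_quarter`; such steps are lattice steps
  (`UpLeft.latticeAdj`) and are seen strictly counterclockwise from the origin, with cross
  product `≥ 1` (`UpLeft.one_le_cross`);
* the vertex bounds `mem_quarter_bounds` (`0 ≤ x ≤ m`, `0 ≤ y ≤ m`, `m² ≤ x² + y² < (m+2)²`),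
  `head_quarter = (m, 0)`, `getLast_quarter = (0, m)`, `getLast_columns_self = (1, m)`, and the
  end of the quarter for `m ≥ 2`: `colRun_one` (`colRun m 1 = [(1, m)]`), `quarter_eq`
  (`quarter m = columns m (m-2) ++ colRun m 2 ++ [(1, m), (0, m)]`), `reverse_quarter_drop_two`,
  `getLast_colRun_two = (2, m)`, `head_columns_append_colRun_two = (m, 0)` (`m ≥ 3`).

Everything is elementary integer arithmetic; statements are per vertex / per consecutive pair
(`List.IsChain`, `List.Mem`), never per index, so that the four-fold symmetric boundary polygons
of `USTPeanoDiscApproximation.lean` can be handled through `map`/`append`/`reverse`.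
-/

namespace Literature.Probability.RandomPlanarGeometry

namespace USTPeano

open List

/-! ### The column heights -/

/-- **Column height** `H x`: the least integer `y ≥ 0` with `x² + y² ≥ m²` (for `x² < m²` it is
`⌊√(m² - x² - 1)⌋ + 1`, else `0`). The staircase occupies, in column `x`, the heights from `H x`
to `H (x - 1)`. [folklore] -/
def colHeight (m : ℕ) (x : ℤ) : ℤ :=
  if x ^ 2 < (m : ℤ) ^ 2 then ((Nat.sqrt (((m : ℤ) ^ 2 - x ^ 2 - 1).toNat) + 1 : ℕ) : ℤ) else 0

variable {m : ℕ}

/-- `H x ≥ 0`. [folklore] -/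
theorem colHeight_nonneg (m : ℕ) (x : ℤ) : 0 ≤ colHeight m x := by
  unfold colHeight; split_ifs <;> positivity

/-- Outside the open disc the column height vanishes. [folklore] -/
theorem colHeight_of_le {x : ℤ} (h : (m : ℤ) ^ 2 ≤ x ^ 2) : colHeight m x = 0 := by
  unfold colHeight; rw [if_neg (not_lt.2 h)]

/-- **`x² + (H x)² ≥ m²`**: the point `(x, H x)` is not inside the circle. [folklore] -/
theorem sq_add_colHeight_sq_ge (m : ℕ) (x : ℤ) : (m : ℤ) ^ 2 ≤ x ^ 2 + colHeight m x ^ 2 := by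
  unfold colHeight
  split_ifs with h
  · set n := (((m : ℤ) ^ 2 - x ^ 2 - 1).toNat) with hn
    have hn' : (n : ℤ) = (m : ℤ) ^ 2 - x ^ 2 - 1 := by rw [hn, Int.toNat_of_nonneg (by omega)]
    have h1 : n < (Nat.sqrt n + 1) ^ 2 := Nat.lt_succ_sqrt' n
    have h2 : (n : ℤ) < ((Nat.sqrt n + 1 : ℕ) : ℤ) ^ 2 := by exact_mod_cast h1
    linarith
  · push Not at h
    simpa using h

/-- **`x² + (H x - 1)² < m²`** when `H x ≥ 1`: one unit lower the point is inside the circle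
(minimality of `H x`). [folklore] -/
theorem sq_add_colHeight_sub_one_sq_lt {x : ℤ} (h : 1 ≤ colHeight m x) :
    x ^ 2 + (colHeight m x - 1) ^ 2 < (m : ℤ) ^ 2 := by
  unfold colHeight at h ⊢
  split_ifs at h ⊢ with hx
  · set n := (((m : ℤ) ^ 2 - x ^ 2 - 1).toNat) with hn
    have hn' : (n : ℤ) = (m : ℤ) ^ 2 - x ^ 2 - 1 := by rw [hn, Int.toNat_of_nonneg (by omega)]
    have h1 : Nat.sqrt n ^ 2 ≤ n := Nat.sqrt_le' n
    have h2 : ((Nat.sqrt n : ℕ) : ℤ) ^ 2 ≤ n := by exact_mod_cast h1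
    push_cast
    linarith
  · omega

/-- Minimality: any `y ≥ 0` with `x² + y² ≥ m²` is `≥ H x`. [folklore] -/
theorem colHeight_le_of_sq_ge {x y : ℤ} (hy : 0 ≤ y) (h : (m : ℤ) ^ 2 ≤ x ^ 2 + y ^ 2) :
    colHeight m x ≤ y := by
  by_contra! hlt
  have h1 : 1 ≤ colHeight m x := by linarith
  have h2 := sq_add_colHeight_sub_one_sq_lt h1
  have h3 : y ≤ colHeight m x - 1 := by linarith
  nlinarith

/-- `H x ≤ m`. [folklore] -/
theorem colHeight_le (m : ℕ) (x : ℤ) : colHeight m x ≤ m :=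
  colHeight_le_of_sq_ge (by positivity) (by nlinarith)

/-- `H (±m) = 0`, in particular `H m = 0`. [folklore] -/
theorem colHeight_self (m : ℕ) : colHeight m m = 0 := colHeight_of_le le_rfl

/-- `H 0 = m`. [folklore] -/
theorem colHeight_zero (m : ℕ) : colHeight m 0 = m := by
  refine le_antisymm (colHeight_le m 0) ?_
  have h := sq_add_colHeight_sq_ge m 0
  have h0 := colHeight_nonneg m 0
  nlinarith

/-- `H 1 = m` for `m ≥ 2` (the circle is flat on top: `(m-1)² + 1 < m²`). [folklore] -/
theorem colHeight_one (hm : 2 ≤ m) : colHeight m 1 = m := by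
  refine le_antisymm (colHeight_le m 1) ?_
  have h := sq_add_colHeight_sq_ge m 1
  have h0 := colHeight_nonneg m 1
  have hm' : (2 : ℤ) ≤ m := by exact_mod_cast hm
  nlinarith

/-- **Monotonicity in `|x|`**: `x'² ≤ x²` implies `H x ≤ H x'`. [folklore] -/
theorem colHeight_mono {x x' : ℤ} (h : x' ^ 2 ≤ x ^ 2) : colHeight m x ≤ colHeight m x' :=
  colHeight_le_of_sq_ge (colHeight_nonneg m x')
    ((sq_add_colHeight_sq_ge m x').trans (by linarith))

/-- In particular `H x ≤ H (x - 1)` for `x ≥ 1`. [folklore] -/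
theorem colHeight_le_pred {x : ℤ} (hx : 1 ≤ x) : colHeight m x ≤ colHeight m (x - 1) :=
  colHeight_mono (by nlinarith)

/-- `H (x - 1) ≥ 1` for `1 ≤ x ≤ m` (the column `x - 1` meets the open disc). [folklore] -/
theorem one_le_colHeight_pred {x : ℤ} (hx : 1 ≤ x) (hxm : x ≤ m) : 1 ≤ colHeight m (x - 1) := by
  by_contra hlt
  have h0 : colHeight m (x - 1) = 0 := by
    have := colHeight_nonneg m (x - 1); omega
  have h := sq_add_colHeight_sq_ge m (x - 1)
  rw [h0] at h
  nlinarith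

/-! ### The staircase: column runs and the quarter -/

/-- The vertical run of `n` lattice points upwards from `(x, y₀)`. [folklore] -/
def vrun (x y₀ : ℤ) : ℕ → List (ℤ × ℤ)
  | 0 => []
  | n + 1 => (x, y₀) :: vrun x (y₀ + 1) n

/-- A run of positive length is nonempty. [folklore] -/
theorem vrun_ne_nil (x y₀ : ℤ) (n : ℕ) : vrun x y₀ (n + 1) ≠ [] := List.cons_ne_nil _ _

/-- Membership in a vertical run. [folklore] -/
theorem mem_vrun_iff {x y₀ : ℤ} {n : ℕ} {p : ℤ × ℤ} :
    p ∈ vrun x y₀ n ↔ p.1 = x ∧ y₀ ≤ p.2 ∧ p.2 < y₀ + n := by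
  induction n generalizing y₀ with
  | zero => simp [vrun]
  | succ n ih =>
    simp only [vrun, List.mem_cons, ih, Nat.cast_add, Nat.cast_one]
    constructor
    · rintro (rfl | ⟨h1, h2, h3⟩)
      · exact ⟨rfl, le_rfl, by linarith⟩
      · exact ⟨h1, by linarith, by linarith⟩
    · rintro ⟨h1, h2, h3⟩
      rcases h2.eq_or_lt with h | h
      · left; ext <;> simp [h1, h]
      · right; exact ⟨h1, by linarith, by linarith⟩

/-- The first point of a run. [folklore] -/
theorem head_vrun (x y₀ : ℤ) (n : ℕ) : (vrun x y₀ (n + 1)).head (vrun_ne_nil x y₀ n) = (x, y₀) := rfl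

/-- The last point of a run. [folklore] -/
theorem getLast_vrun (x y₀ : ℤ) (n : ℕ) :
    (vrun x y₀ (n + 1)).getLast (vrun_ne_nil x y₀ n) = (x, y₀ + n) := by
  induction n generalizing y₀ with
  | zero => simp [vrun]
  | succ n ih =>
    have : vrun x y₀ (n + 1 + 1) = (x, y₀) :: vrun x (y₀ + 1) (n + 1) := rfl
    simp only [this, List.getLast_cons (vrun_ne_nil _ _ _), ih]
    push_cast
    ring_nf

/-- **The step relation of the staircase**: an up-step `(x, y) → (x, y + 1)` in a column
`x ≥ 1`, or a left-step `(x, y) → (x - 1, y)` at a height `y ≥ 1`. [folklore] -/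
def UpLeft (p q : ℤ × ℤ) : Prop :=
  (q = (p.1, p.2 + 1) ∧ 1 ≤ p.1) ∨ (q = (p.1 - 1, p.2) ∧ 1 ≤ p.2)

/-- The staircase step relation is decidable (so `decide` settles concrete staircases).
[folklore] -/
instance : DecidableRel UpLeft := fun p q ↦ by
  unfold UpLeft; infer_instance

/-- Staircase steps are lattice steps. [folklore] -/
theorem UpLeft.latticeAdj {p q : ℤ × ℤ} (h : UpLeft p q) : LatticeAdj p q := by
  rcases h with ⟨rfl, -⟩ | ⟨rfl, -⟩
  · left; exact ⟨rfl, Or.inl rfl⟩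
  · right; exact ⟨rfl, Or.inr (by ring)⟩

/-- A vertical run in a column `x ≥ 1` is a chain of up-steps. [folklore] -/
theorem isChain_upLeft_vrun {x : ℤ} (hx : 1 ≤ x) (y₀ : ℤ) (n : ℕ) : (vrun x y₀ n).IsChain UpLeft := by
  induction n generalizing y₀ with
  | zero => exact List.IsChain.nil
  | succ n ih =>
    change List.IsChain UpLeft ((x, y₀) :: vrun x (y₀ + 1) n)
    rw [List.isChain_cons]
    refine ⟨fun q hq ↦ ?_, ih _⟩
    cases n with
    | zero => simp [vrun] at hq
    | succ n =>
      change q ∈ ((x, y₀ + 1) :: vrun x (y₀ + 1 + 1) n).head? at hq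
      simp only [List.head?_cons, Option.mem_def, Option.some.injEq] at hq
      subst hq
      left; exact ⟨rfl, hx⟩

/-- The vertices of the staircase in column `x`: `(x, H x), (x, H x + 1), …, (x, H (x-1))`.
[folklore] -/
def colRun (m : ℕ) (x : ℤ) : List (ℤ × ℤ) :=
  vrun x (colHeight m x) ((colHeight m (x - 1) - colHeight m x).toNat + 1)

/-- A column run is nonempty. [folklore] -/
theorem colRun_ne_nil (m : ℕ) (x : ℤ) : colRun m x ≠ [] := vrun_ne_nil _ _ _

/-- The first vertex of a column run. [folklore] -/
theorem head_colRun (m : ℕ) (x : ℤ) : (colRun m x).head (colRun_ne_nil m x) = (x, colHeight m x) :=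
  rfl

/-- The last vertex of a column run (for `x ≥ 1`, where `H x ≤ H (x-1)`). [folklore] -/
theorem getLast_colRun {x : ℤ} (hx : 1 ≤ x) :
    (colRun m x).getLast (colRun_ne_nil m x) = (x, colHeight m (x - 1)) := by
  have hle := colHeight_le_pred (m := m) hx
  show (vrun x (colHeight m x) ((colHeight m (x - 1) - colHeight m x).toNat + 1)).getLast
    (vrun_ne_nil _ _ _) = _
  rw [getLast_vrun, Int.toNat_of_nonneg (by linarith)]
  congr 1
  ring

/-- Membership in a column run (`x ≥ 1`). [folklore] -/
theorem mem_colRun_iff {x : ℤ} (hx : 1 ≤ x) {p : ℤ × ℤ} :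
    p ∈ colRun m x ↔ p.1 = x ∧ colHeight m x ≤ p.2 ∧ p.2 ≤ colHeight m (x - 1) := by
  have hle := colHeight_le_pred (m := m) hx
  rw [colRun, mem_vrun_iff]
  push_cast
  rw [Int.toNat_of_nonneg (by linarith)]
  constructor
  · rintro ⟨h1, h2, h3⟩; exact ⟨h1, h2, by linarith⟩
  · rintro ⟨h1, h2, h3⟩; exact ⟨h1, h2, by linarith⟩

/-- A column run in a column `x ≥ 1` is a chain of up-steps. [folklore] -/
theorem isChain_upLeft_colRun {x : ℤ} (hx : 1 ≤ x) : (colRun m x).IsChain UpLeft :=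
  isChain_upLeft_vrun hx _ _

/-- The columns `x = m, m-1, …, m-k+1` of the staircase, concatenated. [folklore] -/
def columns (m : ℕ) : ℕ → List (ℤ × ℤ)
  | 0 => []
  | k + 1 => columns m k ++ colRun m ((m : ℤ) - k)

/-- **The quarter staircase** from `(m, 0)` to `(0, m)`: the columns `x = m, m - 1, …, 1`
followed by the vertex `(0, m)`. [folklore] -/
def quarter (m : ℕ) : List (ℤ × ℤ) :=
  columns m m ++ [((0 : ℤ), (m : ℤ))]

/-- The concatenated columns are nonempty as soon as there is one. [folklore] -/
theorem columns_ne_nil (m : ℕ) (k : ℕ) : columns m (k + 1) ≠ [] := by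
  simp [columns, colRun_ne_nil]

/-- The last vertex of the concatenated columns is the last vertex of the last column.
[folklore] -/
theorem getLast_columns {k : ℕ} (hk : k < m) :
    (columns m (k + 1)).getLast (columns_ne_nil m k) = ((m : ℤ) - k, colHeight m ((m : ℤ) - k - 1)) := by
  simp only [columns]
  rw [List.getLast_append_of_ne_nil _ (colRun_ne_nil _ _), getLast_colRun (by omega)]

/-- The first vertex of the concatenated columns is `(m, H m) = (m, 0)`. [folklore] -/
theorem head_columns (m : ℕ) : ∀ k : ℕ, (columns m (k + 1)).head (columns_ne_nil m k) = ((m : ℤ), 0)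
  | 0 => by
    simp only [columns, List.nil_append]
    rw [head_colRun]
    simp [colHeight_self]
  | k + 1 => by
    have h := head_columns m k
    simp only [columns] at h ⊢
    rw [List.head_append_of_ne_nil]
    exact h

/-- Membership in the concatenated columns. [folklore] -/
theorem mem_columns_iff {k : ℕ} (hk : k ≤ m) {p : ℤ × ℤ} :
    p ∈ columns m k ↔ ∃ x : ℤ, (m : ℤ) - k + 1 ≤ x ∧ x ≤ m ∧ p ∈ colRun m x := by
  induction k with
  | zero => simp [columns]; intro x h1 h2; exfalso; linarith
  | succ k ih =>
    simp only [columns, List.mem_append, ih (by omega)]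
    push_cast
    constructor
    · rintro (⟨x, h1, h2, h3⟩ | h)
      · exact ⟨x, by linarith, h2, h3⟩
      · exact ⟨(m : ℤ) - k, by linarith, by linarith, h⟩
    · rintro ⟨x, h1, h2, h3⟩
      rcases eq_or_lt_of_le h1 with h | h
      · right; rw [show (m : ℤ) - k = x by linarith]; exact h3
      · left; exact ⟨x, by linarith, h2, h3⟩

/-- **The concatenated columns form a chain of `UpLeft` steps** (up-steps inside the columns,
a left-step at height `H (x - 1) ≥ 1` between consecutive columns). [folklore] -/
theorem isChain_upLeft_columns : ∀ {k : ℕ}, k ≤ m → (columns m k).IsChain UpLeft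
  | 0, _ => List.IsChain.nil
  | k + 1, hk => by
    simp only [columns]
    rw [List.isChain_append]
    refine ⟨isChain_upLeft_columns (by omega), isChain_upLeft_colRun (by omega), ?_⟩
    intro p hp q hq
    cases k with
    | zero => simp [columns] at hp
    | succ k =>
      rw [List.getLast?_eq_getLast_of_ne_nil (columns_ne_nil _ _), Option.mem_def,
        Option.some.injEq, getLast_columns (by omega)] at hp
      rw [List.head?_eq_some_head (colRun_ne_nil _ _), Option.mem_def, Option.some.injEq,
        head_colRun] at hq
      subst hp; subst hq
      right
      refine ⟨?_, ?_⟩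
      · have e : (m : ℤ) - ((k : ℤ) + 1) = (m : ℤ) - k - 1 := by ring
        ext <;> simp [e]
      · have := one_le_colHeight_pred (m := m) (x := (m : ℤ) - k) (by omega) (by omega)
        convert this using 2

/-- The last vertex of all the columns is `(1, H 0) = (1, m)` (for `m ≥ 1`). [folklore] -/
theorem getLast_columns_self (hm : 1 ≤ m) :
    (columns m m).getLast (by obtain ⟨n, rfl⟩ : ∃ n, m = n + 1 := ⟨m - 1, by omega⟩; exact columns_ne_nil _ _) =
      (1, (m : ℤ)) := by
  obtain ⟨n, rfl⟩ : ∃ n, m = n + 1 := ⟨m - 1, by omega⟩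
  rw [getLast_columns (Nat.lt_succ_self n)]
  have h0 := colHeight_zero (n + 1)
  ext
  · push_cast; ring
  · simp only
    rw [show ((n + 1 : ℕ) : ℤ) - n - 1 = 0 by push_cast; ring, h0]

/-- `quarter m` is nonempty. [folklore] -/
theorem quarter_ne_nil (m : ℕ) : quarter m ≠ [] := by simp [quarter]

/-- **The quarter staircase is a chain of `UpLeft` steps.** [folklore] -/
theorem isChain_upLeft_quarter (hm : 1 ≤ m) : (quarter m).IsChain UpLeft := by
  rw [quarter, List.isChain_append]
  refine ⟨isChain_upLeft_columns le_rfl, List.isChain_singleton _, ?_⟩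
  intro p hp q hq
  have hne : columns m m ≠ [] := by
    obtain ⟨n, rfl⟩ : ∃ n, m = n + 1 := ⟨m - 1, by omega⟩; exact columns_ne_nil _ _
  rw [List.getLast?_eq_getLast_of_ne_nil hne, Option.mem_def, Option.some.injEq,
    getLast_columns_self hm] at hp
  simp only [List.head?_cons, Option.mem_def, Option.some.injEq] at hq
  subst hp; subst hq
  right
  refine ⟨by simp, ?_⟩
  show (1 : ℤ) ≤ (m : ℤ)
  exact_mod_cast hm

/-- The first vertex of the quarter is `(m, 0)` (for `m ≥ 1`). [folklore] -/
theorem head_quarter (hm : 1 ≤ m) : (quarter m).head (quarter_ne_nil m) = ((m : ℤ), 0) := by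
  obtain ⟨n, rfl⟩ : ∃ n, m = n + 1 := ⟨m - 1, by omega⟩
  simp only [quarter]
  rw [List.head_append_of_ne_nil (columns_ne_nil _ _)]
  exact head_columns (n + 1) n

/-- The last vertex of the quarter is `(0, m)`. [folklore] -/
theorem getLast_quarter (m : ℕ) : (quarter m).getLast (quarter_ne_nil m) = (0, (m : ℤ)) := by
  simp [quarter]

/-- **Vertex bounds**: every vertex `(x, y)` of the quarter satisfies `0 ≤ x ≤ m`, `0 ≤ y ≤ m`
and `m² ≤ x² + y² < (m + 2)²` (it lies in the annulus between the circle of radius `m` and the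
circle of radius `m + 2`). [folklore] -/
theorem mem_quarter_bounds {p : ℤ × ℤ} (hp : p ∈ quarter m) :
    0 ≤ p.1 ∧ p.1 ≤ m ∧ 0 ≤ p.2 ∧ p.2 ≤ m ∧ (m : ℤ) ^ 2 ≤ p.1 ^ 2 + p.2 ^ 2 ∧
      p.1 ^ 2 + p.2 ^ 2 < ((m : ℤ) + 2) ^ 2 := by
  simp only [quarter, List.mem_append, List.mem_singleton] at hp
  rcases hp with hp | rfl
  · obtain ⟨x, h1, h2, h3⟩ := (mem_columns_iff le_rfl).1 hp
    have hx : 1 ≤ x := by linarith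
    obtain ⟨rfl, h4, h5⟩ := (mem_colRun_iff hx).1 h3
    have hH0 := colHeight_nonneg m p.1
    have hH := sq_add_colHeight_sq_ge m p.1
    have hH1 := one_le_colHeight_pred (m := m) hx h2
    have hH2 := sq_add_colHeight_sub_one_sq_lt hH1
    have hH3 := colHeight_le m (p.1 - 1)
    refine ⟨by linarith, h2, by linarith, h5.trans hH3, ?_, ?_⟩
    · nlinarith
    · nlinarith
  · simp only
    have hm : (0 : ℤ) ≤ m := by positivity
    refine ⟨le_rfl, hm, hm, le_rfl, by nlinarith, by nlinarith⟩

/-! ### The last columns of the quarter -/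

/-- The column `x = 1` consists of the single vertex `(1, m)` (`m ≥ 2`). [folklore] -/
theorem colRun_one (hm : 2 ≤ m) : colRun m 1 = [((1 : ℤ), (m : ℤ))] := by
  rw [colRun, show (1 : ℤ) - 1 = 0 by norm_num, colHeight_zero, colHeight_one hm]
  simp [vrun]

/-- **Decomposition of the quarter** near its end: `quarter m = columns m (m-2) ++ colRun m 2 ++
[(1, m), (0, m)]` (`m ≥ 2`). [folklore] -/
theorem quarter_eq (hm : 2 ≤ m) :
    quarter m = columns m (m - 2) ++ (colRun m 2 ++ [((1 : ℤ), (m : ℤ)), (0, m)]) := by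
  obtain ⟨n, rfl⟩ : ∃ n, m = n + 2 := ⟨m - 2, by omega⟩
  simp only [quarter, columns, Nat.add_sub_cancel, List.append_assoc]
  push_cast
  rw [show (n : ℤ) + 2 - (n + 1) = 1 by ring, show (n : ℤ) + 2 - n = 2 by ring, colRun_one hm]
  rfl

/-- The reversed quarter without its two top vertices. [folklore] -/
theorem reverse_quarter_drop_two (hm : 2 ≤ m) :
    ((quarter m).reverse).drop 2 = (columns m (m - 2) ++ colRun m 2).reverse := by
  rw [quarter_eq hm]
  simp

/-- The last vertex of column `2` is `(2, m)` (`m ≥ 2`). [folklore] -/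
theorem getLast_colRun_two (hm : 2 ≤ m) :
    (colRun m 2).getLast (colRun_ne_nil m 2) = ((2 : ℤ), (m : ℤ)) := by
  rw [getLast_colRun (by norm_num), show (2 : ℤ) - 1 = 1 by norm_num, colHeight_one hm]

/-- The first vertex of `columns m (m-2) ++ colRun m 2` is `(m, 0)` (`m ≥ 3`). [folklore] -/
theorem head_columns_append_colRun_two (hm : 3 ≤ m) :
    (columns m (m - 2) ++ colRun m 2).head (by simp [colRun_ne_nil]) = ((m : ℤ), 0) := by
  obtain ⟨n, rfl⟩ : ∃ n, m = n + 3 := ⟨m - 3, by omega⟩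
  show (columns (n + 3) (n + 1) ++ colRun (n + 3) 2).head _ = _
  rw [List.head_append_of_ne_nil (columns_ne_nil _ _)]
  exact head_columns (n + 3) n

/-- Staircase steps are seen counterclockwise from the origin, with cross product `≥ 1`
(`x` for an up-step in column `x ≥ 1`, `y` for a left-step at height `y ≥ 1`), provided the
start has nonnegative coordinates. [folklore] -/
theorem UpLeft.one_le_cross {p q : ℤ × ℤ} (h : UpLeft p q) (hp : 0 ≤ p.1 ∧ 0 ≤ p.2) :
    1 ≤ p.1 * q.2 - p.2 * q.1 := by
  obtain ⟨hp1, hp2⟩ := hp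
  rcases h with ⟨rfl, h1⟩ | ⟨rfl, h1⟩
  · simp only; nlinarith
  · simp only; nlinarith

end USTPeano

end Literature.Probability.RandomPlanarGeometry
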